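import Summits.CriticalPhenomena.SAWScalingLimit.Cruxes.HexTransfer.Lines.yb_relay
import Summits.CriticalPhenomena.SAWScalingLimit.Theses.SAWQuarterTwist
import Summits.CriticalPhenomena.SAWScalingLimit.Theses.SAWSpinMonotone
import Literature.Probability.RandomPlanarGeometry.YangBaxterSAWTheoremsHolds

/-!
# Line `hull-arch-ladder` — a FORWARD LADDER under `HexTransfer` (stmt-CriticalPhenomena-14221)

Forward generator G4 (`ladder-down`). The ladder top is the crux `HexTransfer`
(`= HexSAWScalingLimit (A) → SAWScalingLimit`, landed equivalence with the target given the antecedent: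
`Cruxes.HexTransfer.Negative.hexTransfer_iff_target_of_antecedent`). The top is the summit in another
language; this line does NOT restate it. It climbs from a PROVED FLOOR in the one coordinate in which a
hexagonal ↔ square bridge is mechanised in the tree — Glazman–Manolescu's Yang–Baxter family `H(Θ)`
(Cruxes/HexTransfer/STRATEGY-CENSUS.md §2 R1; live line `Lines/yb_relay.lean`, whose research stub
`stub_angleTransport` this ladder feeds).

* FLOOR (kernel-proved): `GlazmanManolescu2019_thm1_holds` — the boundary two-point function of the
  critical Yang–Baxter walk in the right half-plane `H(Θ)` does not depend on `Θ`.
* GRADED FAMILY `ArchMassRung k`: the same Θ-universality, ASYMPTOTICALLY as the mesh `δ → 0⁺` and up to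
  a factor `1 + ε`, for the ARCH MASSES of `H(Θ) ∖ A`, `A` a union of `≤ k` closed boundary-attached
  rectangles (slits = degenerate rectangles). `k = 0` is the floor (`archMassRung_zero`, file
  `Lines/hull_arch_ladder_special.lean`, no sorry); `k = 1` = ONE SLIT / ONE RECTANGLE is the NEXT RUNG
  (`OneHullArchMass`, crux #1 of the ladder); the family is antitone in the class, so its top is
  `AllHullArchMass = ∀ k, ArchMassRung k`.
* WHY THE FLOOR'S PROOF STOPS AT `k = 1` (located obstruction): GM Prop. 4.2 slides an added rhombus
  through a pair of BI-INFINITE tracks; a slit removes faces, the slider cannot cross the cut, and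
  creating / deleting it next to the cut costs the mass of cut-adjacent visits; hexagonalising the
  `≍ ℓ/δ` cut columns by GM's schedule needs `≍ (ℓ/δ)²` transpositions with an `O(δ²)` relative defect each
  (boundary two-leg exponent `2`) — an `O(1)` budget, not `o(1)`; exact invariance is false at finite mesh
  (Cruxes/HexTransfer/EVIDENCE-ideator1-ybfold.md §C). The new input is a CANCELLATION at the cut: the
  boundary Yang–Baxter (reflection) equation of the dilute O(n→0) model (Yung–Batchelor 1995,
  hep-th/9410042; de Gier–Lee–Rasmussen arXiv:1210.5036 §4, §7) or a linear schedule with a boundary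
  two-leg estimate. That is `stub_shadowDefect`; the Θ-dependence of the UNCUT far tracks is erased by
  GM's own machinery plus an arch-tightness estimate (`stub_farTrackErasure`).
* LADDER TO THE TOP (each step typed, each failing `→ SAWScalingLimit` and `→ HexTransfer` alone):
  `OneHullArchMass →[stub_hullInduction] AllHullArchMass →[stub_limitStep, uses (A)] HullArchTransport
  →[stub_domainExtension, uses (A)] YbRelay.AngleTransport`, then `HexTransfer` BY NAME through
  `YbRelay.HexTransfer_of_stubs` with yb_relay's two tolls `YbRelay.stub_hexFaceRobustExists` (its stub 1b)
  and `YbRelay.stub_ybToUniform` (= item stmt-CriticalPhenomena-16966), SHARED with that line and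
  deliberately not re-registered here.

rung_decl = `Summit.CriticalPhenomena.SAWScalingLimit.Cruxes.HexTransfer.SlitArch.ArchMassRung`;
witness = `Literature.Probability.RandomPlanarGeometry.SAW.YangBaxter.GlazmanManolescu2019_thm1_holds`
(via `archMassRung_zero`). Card: `Lines/hull_arch_ladder.md`; ladder: `LADDER-HexTransfer.md`.
-/

noncomputable section

namespace Summit.CriticalPhenomena.SAWScalingLimit.Cruxes.HexTransfer.SlitArch

open MeasureTheory Filter Topology Set
open scoped NNReal ENNReal BoundedContinuousFunction
open Literature.Probability.RandomPlanarGeometry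
open Literature.Probability.RandomPlanarGeometry.SAW
open Literature.Probability.RandomPlanarGeometry.SAW.YangBaxter
open Summit.CriticalPhenomena.SAWScalingLimit.Theses

/-! ### Vocabulary (to be landed verbatim as a Theorems Defs file by the first worker, P0) -/

/-- ASYMPTOTIC EQUALITY UP TO `1 + ε` of two `ℝ≥0∞`-valued functions of the mesh, as `δ → 0⁺`
(division-free form of "ratio → 1"; symmetric, transitive: `AsympEq.symm`, `AsympEq.trans`). [folklore] -/
def AsympEq (F G : ℝ → ℝ≥0∞) : Prop :=
  ∀ ε : ℝ, 0 < ε → ∀ᶠ δ in 𝓝[>] (0 : ℝ),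
    F δ ≤ ENNReal.ofReal (1 + ε) * G δ ∧ G δ ≤ ENNReal.ofReal (1 + ε) * F δ

/-- The closed boundary-attached rectangle `[0, ℓ] × [h, h']` of the right half-plane (a horizontal
slit of length `ℓ` at height `h` when `h = h'`). [folklore] -/
def bdryRect (ℓ h h' : ℝ) : Set ℂ :=
  {z | 0 ≤ z.re ∧ z.re ≤ ℓ ∧ h ≤ z.im ∧ z.im ≤ h'}

/-- Staircase hulls of complexity `≤ k`: unions of at most `k` closed boundary-attached rectangles
(possibly degenerate, i.e. slits). `RectHulls 0 = {∅}`. [folklore] -/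
def RectHulls (k : ℕ) : Set (Set ℂ) :=
  {A | ∃ (n : ℕ) (ℓ h h' : Fin n → ℝ), n ≤ k ∧ (∀ i, 0 < ℓ i ∧ h i ≤ h' i) ∧
    A = ⋃ i, bdryRect (ℓ i) (h i) (h' i)}

/-- The faces of `H(Θ)` at mesh `δ` whose rescaled closed rhombus avoids the obstacle `A`
(`= halfPlane` when `A = ∅`, by `meshFaces_univ`). [folklore] -/
def hullFaces (Θ : ℤ → ℝ) (A : Set ℂ) (δ : ℝ) : Set Face :=
  halfPlane ∩ meshFaces Θ Aᶜ δ

/-- The ARCH MASS: the critical Yang–Baxter two-point function of `H(Θ) ∖ A` at mesh `δ` between the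
boundary mid-edges of rows `⌊x/δ⌋` and `⌊y/δ⌋`. [cite: GlazmanManolescu2019, §1 (G_Θ(a,b)), §4.2 (G_D(a,b))] -/
def archMass (Θ : ℤ → ℝ) (A : Set ℂ) (δ x y : ℝ) : ℝ≥0∞ :=
  twoPoint (hullFaces Θ A δ) Θ (boundaryPoint ⌊x / δ⌋) (boundaryPoint ⌊y / δ⌋)

/-- ASYMPTOTIC Θ-UNIVERSALITY OF ARCH MASSES over the obstacle class `𝒜`: for every `A ∈ 𝒜`, every
admissible angle sequence `Θ` (values in `[π/3, 2π/3]`) and all boundary heights `x < y` off `A`, the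
arch masses of `H(Θ) ∖ A` and of the hexagonal `H(π/3) ∖ A` are asymptotically equal up to `1 + ε`
(exact equality at every mesh when `A = ∅` is Glazman–Manolescu's Theorem 1).
[cite: GlazmanManolescu2019, Theorem 1] -/
def ArchMassUniv (𝒜 : Set (Set ℂ)) : Prop :=
  ∀ A ∈ 𝒜, ∀ Θ : ℤ → ℝ, (∀ k, Θ k ∈ Set.Icc (Real.pi / 3) (2 * Real.pi / 3)) →
    ∀ x y : ℝ, x < y → (x : ℂ) * Complex.I ∉ A → (y : ℂ) * Complex.I ∉ A →
      AsympEq (fun δ => archMass Θ A δ x y) (fun δ => archMass (fun _ => Real.pi / 3) A δ x y)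

/-- THE GRADED FAMILY: rung `k` = Θ-universality of arch masses for staircase hulls of complexity
`≤ k` (`k = 0`: GM Theorem 1, proved; `k = 1`: the next rung; antitone in `k`).
[cite: GlazmanManolescu2019, Theorem 1] -/
def ArchMassRung (k : ℕ) : Prop := ArchMassUniv (RectHulls k)

/-- Crux #1 of the ladder — THE NEXT RUNG: one boundary-attached slit or rectangle. -/
def OneHullArchMass : Prop := ArchMassRung 1

/-- The top of the graded family: all staircase hulls. -/
def AllHullArchMass : Prop := ∀ k, ArchMassRung k

open Classical in
/-- The FAR-HEXAGONALISED sequence: keep `Θ` on every column at or to the left of a cut column (a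
column of `H(Θ)` containing a face removed by `A` at mesh `δ`), and put `π/3` strictly beyond the last
cut column (for a boundary-attached hull the cut columns form an initial segment; the columns `≤` the
last cut one, hence the removed faces, are the same rhombi in `H(Θ)` and in `H(farHex Θ A δ)`).
[cite: GlazmanManolescu2019, §4 (proof of Theorem 1: tracks exchanged past the walk)] -/
def farHex (Θ : ℤ → ℝ) (A : Set ℂ) (δ : ℝ) : ℤ → ℝ := fun k =>
  if ∃ f : Face, f ∈ halfPlane ∧ k ≤ f.1 ∧ f ∉ meshFaces Θ Aᶜ δ then Θ k else Real.pi / 3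

/-- Sub-rung (a), FAR-TRACK ERASURE: the angles of the tracks NOT cut by the obstacle do not matter
asymptotically — `H(Θ) ∖ A` and `H(farHex Θ A δ) ∖ A` have asymptotically equal arch masses. Intended
proof: GM Prop. 4.2 / Cor. 4.4 exchanges of the bi-infinite tracks beyond the shadow (exact), pushed to
infinity with an arch-tightness estimate (Hammersley–Welsh unfolding + `GlazmanManolescu2019_thm2_holds`).
[cite: GlazmanManolescu2019, Proposition 4.2, Corollary 4.4, proof of Theorem 1] -/
def FarTrackErasure : Prop :=
  ∀ A ∈ RectHulls 1, ∀ Θ : ℤ → ℝ, (∀ k, Θ k ∈ Set.Icc (Real.pi / 3) (2 * Real.pi / 3)) →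
    ∀ x y : ℝ, x < y → (x : ℂ) * Complex.I ∉ A → (y : ℂ) * Complex.I ∉ A →
      AsympEq (fun δ => archMass Θ A δ x y) (fun δ => archMass (farHex Θ A δ) A δ x y)

/-- Sub-rung (b), SHADOW DEFECT (the research content of the rung): hexagonalising the `≍ ℓ/δ` CUT
columns costs `o(1)` relatively — `H(farHex Θ A δ) ∖ A` (angles `Θ` on the shadow of `A`, `π/3`
beyond) and the hexagonal `H(π/3) ∖ A` have asymptotically equal arch masses. No bi-infinite track is
available across the cut: the intended input is a boundary Yang–Baxter / reflection-equation
cancellation at the free ends of the cut tracks, or a linear exchange schedule with a boundary two-leg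
estimate. [cite: GlazmanManolescu2019, §4] [cite: YungBatchelor1995, §2] [cite: deGierLeeRasmussen2013, §4 and §7] -/
def ShadowDefect : Prop :=
  ∀ A ∈ RectHulls 1, ∀ Θ : ℤ → ℝ, (∀ k, Θ k ∈ Set.Icc (Real.pi / 3) (2 * Real.pi / 3)) →
    ∀ x y : ℝ, x < y → (x : ℂ) * Complex.I ∉ A → (y : ℂ) * Complex.I ∉ A →
      AsympEq (fun δ => archMass (farHex Θ A δ) A δ x y) (fun δ => archMass (fun _ => Real.pi / 3) A δ x y)

/-- The critical arch LAW of `H(Θ) ∖ A` at mesh `δ` from the boundary mid-edge of row `⌊x/δ⌋` to that of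
row `⌊y/δ⌋`, pushed to `CurveClass ℂ` (normalised weighted sum of Dirac masses; junk `0` if the mass is
`0` or `∞`). At `A = ∅` this is the `archLaw` of route SAWTrackTransport's `ArchTransport` (stmt-16969).
[cite: GlazmanManolescu2019, §1, eq. (4)] -/
def hullArchLaw (Θ : ℤ → ℝ) (A : Set ℂ) (δ x y : ℝ) : Measure (CurveClass ℂ) :=
  let W : Measure (CurveClass ℂ) :=
    Measure.sum fun γ : YBWalk (hullFaces Θ A δ) (boundaryPoint ⌊x / δ⌋) (boundaryPoint ⌊y / δ⌋) =>
      ENNReal.ofReal (γ.weight Θ) • Measure.dirac (γ.curve Θ δ)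
  (W Set.univ)⁻¹ • W

/-- HULL ARCH TRANSPORT (the limit-level statement the rungs feed): for every staircase hull `A` and
boundary heights `x < y` off `A`, the critical arch laws of `H(π/2) ∖ A` and `H(π/3) ∖ A` are
asymptotically equal on bounded continuous test functions. At `A = ∅` (and `α = π/3`) this is
SAWTrackTransport's `ArchTransport` (stmt-16969). [cite: GlazmanManolescu2019, §1 (the law statement left open, p. 4)] -/
def HullArchTransport : Prop :=
  ∀ k, ∀ A ∈ RectHulls k, ∀ x y : ℝ, x < y → (x : ℂ) * Complex.I ∉ A → (y : ℂ) * Complex.I ∉ A →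
    ∀ f : BoundedContinuousFunction (CurveClass ℂ) ℝ,
      Tendsto (fun δ : ℝ =>
          (∫ c, f c ∂(hullArchLaw (fun (_ : ℤ) => Real.pi / 2) A δ x y)) -
            ∫ c, f c ∂(hullArchLaw (fun (_ : ℤ) => Real.pi / 3) A δ x y))
        (𝓝[>] (0 : ℝ)) (𝓝 0)

/-! ### `AsympEq` is an equivalence-like relation (sorry-free glue) -/

theorem AsympEq.symm {F G : ℝ → ℝ≥0∞} (h : AsympEq F G) : AsympEq G F :=
  fun ε hε => (h ε hε).mono fun _ hδ => ⟨hδ.2, hδ.1⟩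

theorem AsympEq.trans {F G H : ℝ → ℝ≥0∞} (h₁ : AsympEq F G) (h₂ : AsympEq G H) : AsympEq F H := by
  intro ε hε
  set ε' : ℝ := min (ε / 3) 1 with hε'def
  have hε' : 0 < ε' := lt_min (by positivity) one_pos
  have h3 : ε' ≤ ε / 3 := min_le_left _ _
  have h1 : ε' ≤ 1 := min_le_right _ _
  have hsq : (1 + ε') * (1 + ε') ≤ 1 + ε := by nlinarith
  have key : ENNReal.ofReal (1 + ε') * ENNReal.ofReal (1 + ε') ≤ ENNReal.ofReal (1 + ε) := by
    rw [← ENNReal.ofReal_mul (by linarith)]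
    exact ENNReal.ofReal_le_ofReal hsq
  filter_upwards [h₁ ε' hε', h₂ ε' hε'] with δ hFG hGH
  constructor
  · calc F δ ≤ ENNReal.ofReal (1 + ε') * G δ := hFG.1
      _ ≤ ENNReal.ofReal (1 + ε') * (ENNReal.ofReal (1 + ε') * H δ) := by gcongr; exact hGH.1
      _ = (ENNReal.ofReal (1 + ε') * ENNReal.ofReal (1 + ε')) * H δ := (mul_assoc _ _ _).symm
      _ ≤ ENNReal.ofReal (1 + ε) * H δ := by gcongr
  · calc H δ ≤ ENNReal.ofReal (1 + ε') * G δ := hGH.2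
      _ ≤ ENNReal.ofReal (1 + ε') * (ENNReal.ofReal (1 + ε') * F δ) := by gcongr; exact hFG.2
      _ = (ENNReal.ofReal (1 + ε') * ENNReal.ofReal (1 + ε')) * F δ := (mul_assoc _ _ _).symm
      _ ≤ ENNReal.ofReal (1 + ε) * F δ := by gcongr

/-! ### Registered stubs (5; sorries live ONLY here) -/

/-- Stub (a) of the rung — FAR-TRACK ERASURE (provable-now candidate, size L): `FarTrackErasure`. -/
theorem stub_farTrackErasure : FarTrackErasure := by
  sorry

/-- Stub (b) of the rung — SHADOW DEFECT (research, size XL; the cap-lifting input): `ShadowDefect`. -/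
theorem stub_shadowDefect : ShadowDefect := by
  sorry

/-- Stub (c) — THE FAMILY TAIL as a step (size L–XL): one hull ⇒ all staircase hulls (the family is
antitone in the class, so the tail is stated as the step that keeps the rung load-bearing; intended
proof = the rung's mechanism iterated over `k` separated cuts). -/
theorem stub_hullInduction : OneHullArchMass → AllHullArchMass := by
  sorry

/-- Stub (d) — THE LIMIT STEP (research, size XL): arch-MASS universality for all staircase hulls plus
the hexagonal input (A) give arch-LAW transport on hull domains. Why easier than law transport
outright: avoidance probabilities of staircase hulls ARE ratios of arch masses (exact restriction), the
class is closed under fattening, so a portmanteau sandwich identifies every subsequential `π/2`-limit's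
hull-avoidance functional with the `π/3` one, which (A) makes that of SLE(8/3) — a SIMPLE curve, whose
two frontiers then coincide (Choquet–Matheron–Kendall: avoidance functionals on a separating class
determine the law of a random closed set); what remains is curve regularity of the `π/2` arches
(Aizenman–Burchard / Kemppainen–Smirnov criterion) and the half-plane exhaustion. -/
theorem stub_limitStep : AllHullArchMass → HexSAWScalingLimit → HullArchTransport := by
  sorry

/-- Stub (e) — DOMAIN EXTENSION (research, size XL; same species as yb_relay's stub 1b): from law
transport on flat-ended hull domains with boundary endpoints to `YbRelay.AngleTransport` (all Dobrushin
domains, interior endpoint approximations at both angles). Inside the hull class robustness at `π/2` is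
free (transport to `π/3`, perturb there under (A) by Carathéodory-kernel continuity of SLE, transport
back); what remains is lattice placement of `D` and interior-vs-boundary endpoints at `π/2`. -/
theorem stub_domainExtension : HullArchTransport → HexSAWScalingLimit → YbRelay.AngleTransport := by
  sorry

/-! ### The composition (sorry-free) -/

/-- **The next rung from its two sub-rungs**: far-track erasure, then the shadow defect, by
transitivity of `AsympEq`. -/
theorem oneHullArchMass_of (ha : FarTrackErasure) (hb : ShadowDefect) : OneHullArchMass :=
  fun A hA Θ hΘ x y hxy hx hy => (ha A hA Θ hΘ x y hxy hx hy).trans (hb A hA Θ hΘ x y hxy hx hy)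

/-- The rung is the `k = 1` instance of the family top (the family is antitone). -/
theorem oneHullArchMass_of_all (h : AllHullArchMass) : OneHullArchMass := h 1

/-- The whole family from the rung and the tail step. -/
theorem allHullArchMass_of (h₁ : OneHullArchMass) (hc : OneHullArchMass → AllHullArchMass) :
    AllHullArchMass := hc h₁

/-- **The ladder reaches yb_relay's research stub under (A)**: rungs ⇒ hull arch transport ⇒
`AngleTransport`. -/
theorem angleTransport_of (ha : FarTrackErasure) (hb : ShadowDefect)
    (hc : OneHullArchMass → AllHullArchMass)
    (hd : AllHullArchMass → HexSAWScalingLimit → HullArchTransport)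
    (he : HullArchTransport → HexSAWScalingLimit → YbRelay.AngleTransport)
    (hA : HexSAWScalingLimit) : YbRelay.AngleTransport :=
  he (hd (allHullArchMass_of (oneHullArchMass_of ha hb) hc) hA) hA

/-- **`HexTransfer` from the ladder's stubs and yb_relay's two shared tolls** (route
`SAWDefectDecoherence`'s copy): introduce (A), build `AngleTransport` from the ladder, and apply
`YbRelay.HexTransfer_of_stubs` with the landed dictionary, yb_relay's stub 1b and its toll 3 (= stmt-16966). -/
theorem HexTransfer_of_stubs (ha : FarTrackErasure) (hb : ShadowDefect)
    (hc : OneHullArchMass → AllHullArchMass)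
    (hd : AllHullArchMass → HexSAWScalingLimit → HullArchTransport)
    (he : HullArchTransport → HexSAWScalingLimit → YbRelay.AngleTransport)
    (hR : HexSAWScalingLimit → YbRelay.HexFaceSLEExists) (h3 : SAWTrackTransport.YBtoUniform) :
    SAWDefectDecoherence.HexTransfer := by
  intro hA
  exact YbRelay.HexTransfer_of_stubs YbRelay.gmHexDictionary hR (angleTransport_of ha hb hc hd he hA) h3 hA

/-- **The crux from the line's registered stubs**, concluded BY NAME (route `SAWDefectDecoherence`). -/
theorem HexTransfer_of : SAWDefectDecoherence.HexTransfer :=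
  HexTransfer_of_stubs stub_farTrackErasure stub_shadowDefect stub_hullInduction stub_limitStep
    stub_domainExtension YbRelay.stub_hexFaceRobustExists YbRelay.stub_ybToUniform

/-- The same term closes route `SAWPhaseRetrieval`'s copy of the crux. -/
theorem HexTransfer_phaseRetrieval : SAWPhaseRetrieval.HexTransfer := HexTransfer_of

/-- The same term closes route `SAWWindingAlias`'s copy of the crux. -/
theorem HexTransfer_windingAlias : SAWWindingAlias.HexTransfer := HexTransfer_of

/-- The same term closes route `SAWDevelopingMap`'s copy of the crux. -/
theorem HexTransfer_developingMap : SAWDevelopingMap.HexTransfer := HexTransfer_of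

/-- The same term closes route `SAWQuarterTwist`'s copy of the crux. -/
theorem HexTransfer_quarterTwist : SAWQuarterTwist.HexTransfer := HexTransfer_of

/-- The same term closes route `SAWSpinMonotone`'s copy of the crux. -/
theorem HexTransfer_spinMonotone : SAWSpinMonotone.HexTransfer := HexTransfer_of

end Summit.CriticalPhenomena.SAWScalingLimit.Cruxes.HexTransfer.SlitArch

end
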